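import Mathlib
import HarnessLib
import Summits.HubbardSuperconductivity.HubbardSuperconductivity.Theorems.KLProgrammeKLRegimeSplitBundleV6

/-!
# Route `KLProgramme` — crux K3 `KLRegimeTwoPointLimit` (stmt-HubbardSuperconductivity-19937), the two-leg slot: clause (E3a-MS)
# `TwoLegSizesMS` — MULTI-SLOT SIZES of the scale-`n` two-leg piece at an ARBITRARY admissible frame (defect «Δ-stage», seat
# hubbard-kl-k3c3-p2, cell gate-hubbard-kl STATUS 2026-08-26T18:29Z; text offered to the typing authority for the gen-3/gen-4 bundle)

WHY («Δ-stage», HOME/hubbard-kl-k3c3-p2/DEFECT-STAGE.md).  Child 2 (`CountertermP2`) must deliver ONE frame `K ∈ FrameOK R U N μ` (pieces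
`C⁴` with the slot allowances `R.Gfr j·uPow j U·4^{(j-2)m}`, `…SplitPredicates` §5) renormalised at every scale.  The only `C³/C⁴` information the
V6…V10 slots give about the model-dependent pieces `ℓ_n(K) = klTwoLegPieceG … K n` is TIER 2 of `TwoLegSizesG` (BundleV6 §3), whose precondition
`FrameOK R U n μ K` means «`K` has no piece finer than `n`».  Hence a child-2 prover can certify admissibility only for frames assembled from
pieces `ℓ_i(K^{[i]})` FROZEN at frames coarse to level `i` (p2 g4's stage scheme, `frameOK_of_pieces`), and every such frame carries, in its
scale-`n` local part, the staleness `Σ_{i<n} [ℓ_i(K) − ℓ_i(K^{[i]})]`, bounded only by (E3c) `lipBar i · frameDist` ≈ `G.SL·G.S 0·U²/15` —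
independent of `n`, hence above the tolerance `ctCr·|U|·Λ_n²/e₀ ∝ 16^{-n}` at every deep scale; the wholesale fixed point
`K* = −Σ_{i≤n} ℓ_i(K*)` has no staleness but no `FrameOK` certificate (tier 2 fails at every `i < n`).  So `CtOneVolume` (and its V10 twin)
is not certifiable from its hypothesis block.  The cure (engine lineage p1 g6, STATUS 18:38Z: «certifiable, in the chain-rule form; no
objection to folding it into the two-leg slot»; (R-c2) `C²` frames ruled OUT there) is one more ENGINE-OUTPUT conjunct, Δ11′'s own mechanism
made quantitative:

* (E3a-MS) `TwoLegSizesMS … K n`: for EVERY admissible frame (no coarse precondition) the scale-`n` piece splits as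
  `ℓ_n(K) = lp n + Σ_{m ∈ Ioc n N} lp m`, `N = nScales β`, where `lp n` obeys the scale-`n` majorants `twoLegBar G Q U j n` for ALL `j ≤ 4`,
  and the slot-`m` part (`n < m ≤ N`) is a LEGAL SLOT-`m` FRAME PIECE up to the small factor `msBar G Q U n`:
  `‖Dʲ lp m‖ ≤ msBar G Q U n · R.Gfr j · uPow j U · 4^{(j-2)m}`, `j ≤ 4`.  Mechanism (p1 g6): `ℓ_n(K)` is the scale-`n` increment read on the
  frame's own curve `k_F^K`; the slot-`m` structure of `K` enters only through the curve map, at first order as (normal slope of the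
  scale-`n` increment, `≍ twoLegBar G Q U 1 n = (S 1 + S′ 1|U|)·U²·4^{-n}`) × (displacement by the slot-`m` piece `/ v_F`), cross terms one
  more `Gfr·U` down — hence `msBar G Q U n := klMsKappa · twoLegBar G Q U 1 n` (QUADRATIC in `U`, the engine's natural size; the numeral
  `klMsKappa` absorbs `2/v_F ≤ 4` on the tube, the Faà di Bruno combinatorics up to order 4 and the cross terms).  At `n = nScales β + 1`
  (the engine's last ladder step) `Ioc n N = ∅` and the clause is plain scale-`n` smoothness, as tier 2 there.
* `TwoLegStepGM hist … := TwoLegStepG hist … ∧ TwoLegSizesMS …` — the packaging a bundle's two-leg slot would carry next to (E3g):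
  `TwoLegStepV11 := TwoLegStepG hist ∧ TwoLegSizesMS ∧ TwoLegAngularG ∧ TwoLegVolumeRate (hist ∧ TwoLegStepG hist ∧ TwoLegSizesMS ∧ TwoLegAngularG)`
  (names to the typing authority).

How child 2 consumes it (the «fixed point on FrameOK's tube»): WHOLESALE scale-by-scale continuation `K*_{(n)} = −Σ_{i≤n} ℓ_i(K*_{(n)})`
by finitely many Picard steps per level; the slot-`m` piece of `−Σ_{i≤n} ℓ_i(K)` is `lp^{(m)} m + Σ_{i<m, i≤n} lp^{(i)} m` with
`‖Dʲ·‖ ≤ twoLegBar j m + (Σ_{i<m} msBar i)·Gfr j·uPow j·4^{(j-2)m} ≤ Gfr j·uPow j·4^{(j-2)m}` once `R.Gfr j ≥ 2(G.S j + 1)`, `Q.S′ j·|U| ≤ 1` and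
`Σ_i msBar i ≤ klMsKappa·(S 1 + S′ 1|U|)·U²·4/3 ≤ ½` (`sum_msBar_le` below) — SELF-MAP with no coarse precondition; contraction from (E3c);
renormalisation from the node identity + tails (all pieces at the SAME frame: no staleness); `∀ θ` from (E3g).  Definitions + bookkeeping only;
nothing is asserted about the Hubbard model.  References: BGM 2006 [arXiv:cond-mat/0507686] (2.36), (2.42); FST IV, CPAM 53 (2000) 1350
(inversion with loss of derivatives); HOME/hubbard-kl-k3c3-p2/DEFECT-STAGE.md §2–§6; STATUS p1 g6 2026-08-26T18:38:18Z.
-/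

noncomputable section

namespace Summit.HubbardSuperconductivity.HubbardSuperconductivity.Theorems.KLRegimeSplit

set_option linter.dupNamespace false -- summit = problem name (single-conjunct summit), D-0017

open Real Finset
open Literature.MathematicalPhysics.QuantumLattice Literature.Probability.LatticeModels
open Summit.HubbardSuperconductivity.HubbardSuperconductivity.Theorems.KLProgrammeLegKernels

/-! ## §1 The multi-slot majorant -/

/-- The numeral of (E3a-MS): absorbs `2/v_F ≤ 4` (radial transversality of the band on the tube), the chain-rule combinatorics up to order
`4` and the higher cross terms.  FIXED: `64`. -/
def klMsKappa : ℝ := 64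

/-- **(E3a-MS) factor** in front of the slot-`m` frame allowance for the slot-`m` part (`m > n`) of the scale-`n` two-leg piece:
`msBar G Q U n = klMsKappa · twoLegBar G Q U 1 n = klMsKappa·(S 1 + S′ 1·|U|)·U²·4^{-n}` — the normal slope of the scale-`n` increment. -/
def msBar (G : GeoConsts) (Q : EngConsts) (U : ℝ) (n : ℕ) : ℝ := klMsKappa * twoLegBar G Q U 1 n

/-! ## §2 The clause -/

section Model

variable (L M : ℕ) [NeZero L] [NeZero M]

/-- **(E3a-MS) `TwoLegSizesMS G Q R … K n`** — MULTI-SLOT SIZES of the scale-`n` piece `ℓ_n(K) = klTwoLegPieceG … K n` at an ARBITRARY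
(admissible) frame: there are frames `lp m` with `ℓ_n(K) = lp n + Σ_{m ∈ Ioc n (nScales β)} lp m` pointwise, `lp n` within the scale-`n`
majorants `twoLegBar G Q U j n` for every `j ≤ 4`, and each `lp m`, `n < m ≤ nScales β`, within `msBar G Q U n` times the SLOT-`m` frame allowance
`R.Gfr j · uPow j U · 4^{(j-2)m}`, `j ≤ 4` — uniformly in the volume `(L, M)`.  ENGINE OUTPUT (the `C⁴` structure of the scale-`n` output read on a
frame with pieces at every slot); child 2's input for the self-map of the wholesale counterterm iteration («Δ-stage»). -/
def TwoLegSizesMS (G : GeoConsts) (Q : EngConsts) (R : RenConsts) (β U μ : ℝ) (K : TrigPolyC4v) (n : ℕ) : Prop :=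
  ∃ lp : ℕ → TrigPolyC4v,
    (∀ p : Fin 2 → ℝ,
        (klTwoLegPieceG L M β U μ K n).eval p = (lp n).eval p + ∑ m ∈ Ioc n (nScales β), (lp m).eval p) ∧
    (∀ j ≤ 4, ∀ q : Momentum, ‖iteratedFDeriv ℝ j (evalM (lp n)) q‖ ≤ twoLegBar G Q U j n) ∧
    (∀ m ∈ Ioc n (nScales β), ∀ j ≤ 4, ∀ q : Momentum,
        ‖iteratedFDeriv ℝ j (evalM (lp m)) q‖ ≤ msBar G Q U n * (R.Gfr j * uPow j U * (4 : ℝ) ^ (((j : ℤ) - 2) * m)))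

/-- **`TwoLegStepGM hist G P Q R … K n`** := `TwoLegStepG hist … ∧ TwoLegSizesMS …` — the «G» two-leg step (two-tier sizes, floor,
frame-Lipschitz, slopes) together with (E3a-MS); the shape a bundle's two-leg slot and its (E3f) comparison-volume antecedent would carry
(next to (E3g) `TwoLegAngularG`). -/
def TwoLegStepGM (hist : TrigPolyC4v → ℕ → Prop) (G : GeoConsts) (P : SplitConsts) (Q : EngConsts) (R : RenConsts)
    (β U μ : ℝ) (K : TrigPolyC4v) (n : ℕ) : Prop :=
  TwoLegStepG L M hist G P Q R β U μ K n ∧ TwoLegSizesMS L M G Q R β U μ K n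

end Model

/-! ## §3 Bookkeeping -/

/-- `0 < klMsKappa`. -/
theorem klMsKappa_pos : 0 < klMsKappa := by norm_num [klMsKappa]

/-- The two-leg majorants are nonnegative for well-formed constants. -/
theorem twoLegBar_nonneg' {G : GeoConsts} {Q : EngConsts} (hG : G.WF) (hQ : Q.WF) (U : ℝ) (j n : ℕ) :
    0 ≤ twoLegBar G Q U j n := by
  have hS : 0 ≤ G.S j := hG.2.2.2.2.2.2.2.2.2.2.2.2.2.2.2.2.2.1 j
  have hS' : 0 ≤ Q.S' j := hQ.2.2.2.2.1 j
  unfold twoLegBar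
  exact mul_nonneg (mul_nonneg (by positivity) (uPow_nonneg j U)) (zpow_nonneg (by norm_num) _)

/-- `msBar ≥ 0` for well-formed constants. -/
theorem msBar_nonneg {G : GeoConsts} {Q : EngConsts} (hG : G.WF) (hQ : Q.WF) (U : ℝ) (n : ℕ) : 0 ≤ msBar G Q U n :=
  mul_nonneg klMsKappa_pos.le (twoLegBar_nonneg' hG hQ U 1 n)

/-- The closed form: `msBar G Q U n = klMsKappa·(S 1 + S′ 1·|U|)·U²·(4ⁿ)⁻¹`. -/
theorem msBar_eq (G : GeoConsts) (Q : EngConsts) (U : ℝ) (n : ℕ) :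
    msBar G Q U n = klMsKappa * (G.S 1 + Q.S' 1 * |U|) * U ^ 2 * ((4 : ℝ) ^ n)⁻¹ := by
  unfold msBar twoLegBar
  have h : (4 : ℝ) ^ ((((1 : ℕ) : ℤ) - 2) * (n : ℤ)) = ((4 : ℝ) ^ n)⁻¹ := by
    rw [show (((1 : ℕ) : ℤ) - 2) * (n : ℤ) = -(n : ℤ) by push_cast; ring, zpow_neg, zpow_natCast]
  rw [h, uPow_succ]
  ring

/-- **The self-map arithmetic of (E3a-MS)**: `Σ_{n<N'} msBar G Q U n ≤ klMsKappa·(S 1 + S′ 1·|U|)·U²·(4/3)` (geometric series), for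
well-formed constants. -/
theorem sum_msBar_le {G : GeoConsts} {Q : EngConsts} (hG : G.WF) (hQ : Q.WF) (U : ℝ) (N' : ℕ) :
    ∑ n ∈ range N', msBar G Q U n ≤ klMsKappa * (G.S 1 + Q.S' 1 * |U|) * U ^ 2 * (4 / 3) := by
  have hS : 0 ≤ G.S 1 := hG.2.2.2.2.2.2.2.2.2.2.2.2.2.2.2.2.2.1 1
  have hS' : 0 ≤ Q.S' 1 := hQ.2.2.2.2.1 1
  have hc : 0 ≤ klMsKappa * (G.S 1 + Q.S' 1 * |U|) * U ^ 2 := by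
    have := klMsKappa_pos
    positivity
  simp_rw [msBar_eq]
  rw [← mul_sum]
  refine mul_le_mul_of_nonneg_left ?_ hc
  have hgeom : ∑ n ∈ range N', ((4 : ℝ) ^ n)⁻¹ ≤ 4 / 3 := by
    have h1 : ∑ n ∈ range N', ((4 : ℝ) ^ n)⁻¹ = ∑ n ∈ range N', ((1 : ℝ) / 4) ^ n := by
      refine sum_congr rfl fun n _ => ?_
      rw [one_div, inv_pow]
    rw [h1]
    have h2 := geom_sum_Ico_le_of_lt_one (m := 0) (n := N') (x := (1 : ℝ) / 4) (by norm_num) (by norm_num)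
    rw [Finset.range_eq_Ico]
    refine h2.trans ?_
    norm_num
  exact hgeom

section Model

variable {L M : ℕ} [NeZero L] [NeZero M]

/-- (E3a-MS) gives the «G» step back. -/
theorem TwoLegStepGM.step {hist : TrigPolyC4v → ℕ → Prop} {G : GeoConsts} {P : SplitConsts} {Q : EngConsts} {R : RenConsts}
    {β U μ : ℝ} {K : TrigPolyC4v} {n : ℕ} (h : TwoLegStepGM L M hist G P Q R β U μ K n) :
    TwoLegStepG L M hist G P Q R β U μ K n := h.1

/-- (E3a-MS) from the augmented step. -/
theorem TwoLegStepGM.multiSlot {hist : TrigPolyC4v → ℕ → Prop} {G : GeoConsts} {P : SplitConsts} {Q : EngConsts} {R : RenConsts}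
    {β U μ : ℝ} {K : TrigPolyC4v} {n : ℕ} (h : TwoLegStepGM L M hist G P Q R β U μ K n) :
    TwoLegSizesMS L M G Q R β U μ K n := h.2

/-- Past the frame class (`nScales β < n`, e.g. the engine's last step `n = nScales β + 1`) the multi-slot clause is plain scale-`n`
smoothness: a single piece `lp n` obeying `twoLegBar G Q U j n`, `j ≤ 4`, represents `ℓ_n(K)`. -/
theorem TwoLegSizesMS.of_single {G : GeoConsts} {Q : EngConsts} {R : RenConsts} {β U μ : ℝ} {K : TrigPolyC4v} {n : ℕ}
    (hn : nScales β < n)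
    (h : ∀ j ≤ 4, ∀ q : Momentum, ‖iteratedFDeriv ℝ j (evalM (klTwoLegPieceG L M β U μ K n)) q‖ ≤ twoLegBar G Q U j n) :
    TwoLegSizesMS L M G Q R β U μ K n := by
  refine ⟨fun _ => klTwoLegPieceG L M β U μ K n, fun p => ?_, h, fun m hm => ?_⟩
  · have : Ioc n (nScales β) = ∅ := Finset.Ioc_eq_empty (by omega)
    simp [this]
  · exact absurd (Finset.mem_Ioc.mp hm) (by omega)

/-- **What child 2 reads: the scale-`n` piece is bounded in every slot.**  Under (E3a-MS), for each `m` with `n < m ≤ nScales β` the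
slot-`m` part of `ℓ_n(K)` is within `msBar G Q U n` of a legal slot-`m` frame piece (restated accessor). -/
theorem TwoLegSizesMS.fine {G : GeoConsts} {Q : EngConsts} {R : RenConsts} {β U μ : ℝ} {K : TrigPolyC4v} {n : ℕ}
    (h : TwoLegSizesMS L M G Q R β U μ K n) :
    ∃ lp : ℕ → TrigPolyC4v,
      (∀ p : Fin 2 → ℝ,
          (klTwoLegPieceG L M β U μ K n).eval p = (lp n).eval p + ∑ m ∈ Ioc n (nScales β), (lp m).eval p) ∧
      (∀ j ≤ 4, ∀ q : Momentum, ‖iteratedFDeriv ℝ j (evalM (lp n)) q‖ ≤ twoLegBar G Q U j n) ∧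
      ∀ m ∈ Ioc n (nScales β), ∀ j ≤ 4, ∀ q : Momentum,
        ‖iteratedFDeriv ℝ j (evalM (lp m)) q‖ ≤ msBar G Q U n * (R.Gfr j * uPow j U * (4 : ℝ) ^ (((j : ℤ) - 2) * m)) := h

end Model

end Summit.HubbardSuperconductivity.HubbardSuperconductivity.Theorems.KLRegimeSplit

end
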